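import Summits.QuantumFields.YangMills.Theorems.SwapVirialDeficitQuantitativeLaplaceFibredChartCubic
import HarnessLib

/-!
# The √b bulk law with base hypotheses ON A BASE SET `S` only (free-hands support of ⟨stmt-QuantumFields-24197⟩ `SwapVirialDeficit.SwapGluedStiffness`;
# generic sequel of ✓`…QuantitativeLaplaceFibredChartCubic` §3)

✓`laplaceMethod_quantitative_fibred_chart_cubic_offBound` quantifies its fibre data (`hA`, `hcoer`, `hw₀`, `hρ`, `hη`, `hf`, `hw`) over EVERY base point `p : M`
and integrates the main term over all of `(M, ν)`.  In the steep-window Morse–Bott plan of LEAD ym-line-sfw-p2 g97 the base type is `ℝ × ℝ` (the axial letters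
`x₀, y₀` of the gnomonic chart, ✓`BlowUpRing.gnoFibreEquiv`), but the transverse Hessian is uniformly coercive only on the BULK SQUARE `S = {|x₀|, |y₀| ≤ V₀}`
(w3 g65's ✓`fibre_raySecond_coercive_gnomonic`: `κ_x ∼ (2 + x₀²)⁻¹`).  This file supplies the version the assembler needs:

* ★★★ `laplaceMethod_quantitative_fibred_chart_cubic_offBound_on` — every base hypothesis restricted to `p ∈ S` (`S` measurable, non-empty), the tube
  `S ×ˢ B̄(0,R)` and its chart identity `μ|_{Ψ(S × B̄_R)} = Ψ_*((J·ν⊗dy)|_{S×B̄_R})`, the off-tube bound `‖e^{−β(f−f₀)}φ‖ ≤ E_off` a.e. off `Ψ(S × B̄_R)`; conclusion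
  `|∫_X e^{−β(f−f₀)}φ dμ − 𝔐_S(β)| ≤ (K₃/√β + 16(m+8)/(λR²β))·𝔐_S(β) + E_off·μ(X)` with `𝔐_S(β) = (2π/β)^{m/2} ∫_{p ∈ S} w₀ p/√det(A p) dν`.
  Proof: the projection trick — `π p := p` on `S`, `:= p₀` off `S`; apply the `∀ p` theorem to `Ψ ∘ (π × id)`, `A ∘ π`, `w₀ ∘ π`, … and the base measure `ν|_S`,
  on which `π = id` a.e. (✓`Measure.map_congr`, ✓`withDensity_congr_ae`).

HONEST FRAMING: measure-theoretic glue; width 0 by itself toward any lattice statement; ⟨24197⟩, ⟨24196⟩, ⟨24194⟩, ⟨24497⟩ and every rung ∕ summit statement stay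
OPEN; own crux ⟨22884⟩ OPEN (blocked-on ⟨19935⟩); the Yang–Mills mass gap is NOT proved; no summit is proved by a line.  Width seat ym-line-sfw-p2-w2 g59 (cell
ym-idea-1, free hands), `--supports stmt-QuantumFields-24197`.  THEOREMS ONLY (0 `def`, 0 `sorry`), standard axioms.

## References
* M. Hasenpflug, D. Rudolf, B. Sprungk, Ann. Appl. Probab. 34 (2024), §3.1 Assumption 3 (T), App. 4.1 Thm 16. [HasenpflugRudolfSprungk2024]
* K. W. Breitung, *Asymptotic Approximations for Probability Integrals*, LNM 1592 (1994), §2.3 Definitions 4–5. [Breitung1994]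
-/

set_option autoImplicit false

noncomputable section

open _root_.MeasureTheory _root_.Filter _root_.Set _root_.Module _root_.Metric
open scoped _root_.Topology _root_.Real _root_.InnerProductSpace _root_.ENNReal

namespace Summit.QuantumFields.YangMills.Theorems.QuantitativeLaplace

section ProjectionTrick

variable {M : Type*} [MeasurableSpace M]

omit [MeasurableSpace M] in
/-- The base projection `π p = p` on `S`, `= p₀` off `S` lands in `S`. [folklore] -/
theorem baseProj_mem {S : Set M} {p₀ : M} (hp₀ : p₀ ∈ S) [DecidablePred (· ∈ S)] (p : M) : (if p ∈ S then p else p₀) ∈ S := by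
  by_cases hp : p ∈ S
  · rw [if_pos hp]; exact hp
  · rw [if_neg hp]; exact hp₀

/-- The base projection is measurable. [folklore] -/
theorem measurable_baseProj {S : Set M} (hS : MeasurableSet S) (p₀ : M) [DecidablePred (· ∈ S)] : Measurable fun p : M => if p ∈ S then p else p₀ :=
  Measurable.ite hS measurable_id measurable_const

omit [MeasurableSpace M] in
/-- The image of `univ ×ˢ B` under `Ψ ∘ (π × id)` is the image of `S ×ˢ B` under `Ψ`. [folklore] -/
theorem image_baseProj_prod {V X : Type*} {S : Set M} {p₀ : M} (hp₀ : p₀ ∈ S) [DecidablePred (· ∈ S)] (Ψ : M × V → X) (B : Set V) :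
    (fun z : M × V => Ψ ((if z.1 ∈ S then z.1 else p₀), z.2)) '' ((univ : Set M) ×ˢ B) = Ψ '' (S ×ˢ B) := by
  ext x
  constructor
  · rintro ⟨⟨p, y⟩, ⟨-, hy⟩, rfl⟩
    exact ⟨((if p ∈ S then p else p₀), y), ⟨baseProj_mem hp₀ p, hy⟩, rfl⟩
  · rintro ⟨⟨p, y⟩, ⟨hp, hy⟩, rfl⟩
    refine ⟨(p, y), ⟨mem_univ _, hy⟩, ?_⟩
    simp only [if_pos hp]

end ProjectionTrick

section CubicOffOn

variable {X : Type*} [MeasurableSpace X] {μ : Measure X} [IsFiniteMeasure μ]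
variable {M : Type*} [MeasurableSpace M] {ν : Measure M} [SFinite ν]
variable {V : Type*} [NormedAddCommGroup V] [InnerProductSpace ℝ V] [FiniteDimensional ℝ V]
  [MeasurableSpace V] [BorelSpace V]

/-- ★★★ **The √b bulk law with base hypotheses on a measurable base set `S` only.**  As ✓`laplaceMethod_quantitative_fibred_chart_cubic_offBound`, but: `S ⊆ M`
measurable with a point `p₀ ∈ S`; symmetry ∕ coercivity of `A p`, `0 ≤ w₀ p`, the Taylor data `hρ hη hf hw` only for `p ∈ S`; `w₀` integrable on `S`; the tube is
`S ×ˢ B̄(0,R)` with chart identity `μ|_{Ψ(S × B̄_R)} = Ψ_*(((ν ⊗ vol)|_{S × B̄_R})·J)` (`J ≥ 0` there) and the off-tube bound is required off `Ψ(S × B̄_R)`; the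
main term is `𝔐_S(β) = (2π/β)^{m/2}·∫_{p ∈ S} w₀ p/√det(A p) dν`.  [cite: HasenpflugRudolfSprungk2024, App. 4.1 Thm 16] [cite: Breitung1994, §2.3 Definitions 4–5] -/
theorem laplaceMethod_quantitative_fibred_chart_cubic_offBound_on {Ψ : M × V → X} {J : M × V → ℝ} {f φ : X → ℝ} {f₀ : ℝ}
    {S : Set M} (hS : MeasurableSet S) {p₀ : M} (hp₀ : p₀ ∈ S)
    {A : M → V →ₗ[ℝ] V} (hA : ∀ p ∈ S, (A p).IsSymmetric) {lam : ℝ} (hlam : 0 < lam)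
    (hcoer : ∀ p ∈ S, ∀ y : V, lam * ‖y‖ ^ 2 ≤ ⟪A p y, y⟫_ℝ)
    (hAm : Measurable fun z : M × V => ⟪A z.1 z.2, z.2⟫_ℝ)
    {R A₃ D β Eoff : ℝ} (hR : 0 < R) (hA₃ : 0 ≤ A₃) (hD : 0 ≤ D) (hβ : 0 < β)
    (hsmall : A₃ * R ≤ lam / (8 * ((finrank ℝ V : ℝ) + 8))) (hDR : D * R ≤ 1)
    (hΨ : Measurable Ψ) (hΨT : MeasurableSet (Ψ '' (S ×ˢ closedBall (0 : V) R)))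
    (hJm : Measurable J) (hJ0 : ∀ z ∈ S ×ˢ closedBall (0 : V) R, 0 ≤ J z)
    (hchart : μ.restrict (Ψ '' (S ×ˢ closedBall (0 : V) R)) =
      (((ν.prod volume).restrict (S ×ˢ closedBall (0 : V) R)).withDensity fun z => ENNReal.ofReal (J z)).map Ψ)
    (hfm : Measurable f) (hφm : Measurable φ)
    {ρ η : M × V → ℝ} {w₀ : M → ℝ} (hρ_meas : Measurable ρ) (hη_meas : Measurable η)
    (hw₀m : Measurable w₀) (hw₀ : ∀ p ∈ S, 0 ≤ w₀ p) (hw₀i : IntegrableOn w₀ S ν)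
    (hρ : ∀ p ∈ S, ∀ y : V, ‖y‖ ≤ R → |ρ (p, y)| ≤ A₃ * ‖y‖ ^ 3) (hη : ∀ p ∈ S, ∀ y : V, ‖y‖ ≤ R → |η (p, y)| ≤ D * ‖y‖)
    (hf : ∀ p ∈ S, ∀ y : V, ‖y‖ ≤ R → f (Ψ (p, y)) - f₀ = (1 / 2) * ⟪A p y, y⟫_ℝ + ρ (p, y))
    (hw : ∀ p ∈ S, ∀ y : V, ‖y‖ ≤ R → J (p, y) * φ (Ψ (p, y)) = w₀ p * (1 + η (p, y)))
    (hEoff : 0 ≤ Eoff)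
    (hoff : ∀ᵐ x ∂μ, x ∉ Ψ '' (S ×ˢ closedBall (0 : V) R) → ‖Real.exp (-(β * (f x - f₀))) * φ x‖ ≤ Eoff) :
    Integrable (fun x => Real.exp (-(β * (f x - f₀))) * φ x) μ ∧
    |(∫ x, Real.exp (-(β * (f x - f₀))) * φ x ∂μ) -
        (2 * π / β) ^ ((finrank ℝ V : ℝ) / 2) * ∫ p in S, w₀ p / Real.sqrt (LinearMap.det (A p)) ∂ν| ≤
      ((16 * A₃ * ((finrank ℝ V : ℝ) + 8) / lam + 256 * A₃ * ((finrank ℝ V : ℝ) + 8) ^ 2 / lam ^ 2 + D + 8 * D * ((finrank ℝ V : ℝ) + 8) / lam) /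
          Real.sqrt β + 16 * ((finrank ℝ V : ℝ) + 8) / (lam * R ^ 2) / β) *
        ((2 * π / β) ^ ((finrank ℝ V : ℝ) / 2) * ∫ p in S, w₀ p / Real.sqrt (LinearMap.det (A p)) ∂ν) +
      Eoff * μ.real univ := by
  classical
  -- the base projection and the reparametrised data
  set prj : M → M := fun p => if p ∈ S then p else p₀ with hprjdef
  have hprjS : ∀ p, prj p ∈ S := fun p => baseProj_mem hp₀ p
  have hprjm : Measurable prj := measurable_baseProj hS p₀
  have hprjid : ∀ p ∈ S, prj p = p := fun p hp => by simp only [hprjdef, if_pos hp]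
  set Prj : M × V → M × V := fun z => (prj z.1, z.2) with hPrjdef
  have hPrjm : Measurable Prj := (hprjm.comp measurable_fst).prodMk measurable_snd
  have hPrjid : ∀ z ∈ S ×ˢ (univ : Set V), Prj z = z := fun z hz => by
    simp only [hPrjdef, hprjid z.1 hz.1]
  set ν' : Measure M := ν.restrict S with hν'
  -- the tube image is unchanged
  have himg : (fun z : M × V => Ψ (Prj z)) '' ((univ : Set M) ×ˢ closedBall (0 : V) R) = Ψ '' (S ×ˢ closedBall (0 : V) R) :=
    image_baseProj_prod hp₀ Ψ (closedBall (0 : V) R)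
  -- the reparametrised tube measure is the old one
  have hT : MeasurableSet (S ×ˢ closedBall (0 : V) R) := hS.prod measurableSet_closedBall
  have hκ : (ν'.prod volume).restrict ((univ : Set M) ×ˢ closedBall (0 : V) R) = (ν.prod volume).restrict (S ×ˢ closedBall (0 : V) R) := by
    rw [hν', ← Measure.restrict_univ (μ := (volume : Measure V)), Measure.prod_restrict, Measure.restrict_univ, Measure.restrict_restrict
      (MeasurableSet.univ.prod measurableSet_closedBall), Set.prod_inter_prod, Set.univ_inter, Set.inter_univ]
  have haeT : ∀ᵐ z ∂(ν.prod volume).restrict (S ×ˢ closedBall (0 : V) R), z ∈ S ×ˢ closedBall (0 : V) R := ae_restrict_mem hT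
  have hJ' : (((ν.prod volume).restrict (S ×ˢ closedBall (0 : V) R)).withDensity fun z => ENNReal.ofReal (J (Prj z))) =
      ((ν.prod volume).restrict (S ×ˢ closedBall (0 : V) R)).withDensity fun z => ENNReal.ofReal (J z) := by
    refine withDensity_congr_ae ?_
    filter_upwards [haeT] with z hz
    rw [hPrjid z ⟨hz.1, mem_univ _⟩]
  have hchart' : μ.restrict ((fun z : M × V => Ψ (Prj z)) '' ((univ : Set M) ×ˢ closedBall (0 : V) R)) =
      (((ν'.prod volume).restrict ((univ : Set M) ×ˢ closedBall (0 : V) R)).withDensity fun z => ENNReal.ofReal (J (Prj z))).map (fun z : M × V => Ψ (Prj z)) := by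
    rw [himg, hκ, hJ', hchart]
    refine Measure.map_congr ?_
    have hac : ((ν.prod volume).restrict (S ×ˢ closedBall (0 : V) R)).withDensity (fun z => ENNReal.ofReal (J z)) ≪
        (ν.prod volume).restrict (S ×ˢ closedBall (0 : V) R) := withDensity_absolutelyContinuous _ _
    refine hac.ae_le ?_
    filter_upwards [haeT] with z hz
    show Ψ z = Ψ (Prj z)
    rw [hPrjid z ⟨hz.1, mem_univ _⟩]
  -- integrability of `w₀ ∘ prj` on `ν|_S`
  have hw₀i' : Integrable (fun p => w₀ (prj p)) ν' := by
    refine (hw₀i.congr ?_)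
    filter_upwards [ae_restrict_mem hS] with p hp
    rw [hprjid p hp]
  -- apply the `∀ p` theorem to the reparametrised data
  obtain ⟨hint, hbd⟩ := laplaceMethod_quantitative_fibred_chart_cubic_offBound (μ := μ) (ν := ν') (Ψ := fun z => Ψ (Prj z)) (J := fun z => J (Prj z))
    (f := f) (φ := φ) (f₀ := f₀) (A := fun p => A (prj p)) (fun p => hA _ (hprjS p)) hlam (fun p y => hcoer _ (hprjS p) y)
    (hAm.comp hPrjm) hR hA₃ hD hβ hsmall hDR (hΨ.comp hPrjm) (by rw [himg]; exact hΨT) (hJm.comp hPrjm)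
    (fun z hz => hJ0 (Prj z) ⟨hprjS z.1, hz.2⟩) hchart' hfm hφm (ρ := fun z => ρ (Prj z)) (η := fun z => η (Prj z)) (w₀ := fun p => w₀ (prj p))
    (hρ_meas.comp hPrjm) (hη_meas.comp hPrjm) (hw₀m.comp hprjm) (fun p => hw₀ _ (hprjS p)) hw₀i'
    (fun p y hy => hρ _ (hprjS p) y hy) (fun p y hy => hη _ (hprjS p) y hy) (fun p y hy => hf _ (hprjS p) y hy) (fun p y hy => hw _ (hprjS p) y hy) hEoff
    (by simpa only [himg] using hoff)
  -- the main term over `ν|_S` is the main term over `S`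
  have hmain : ∫ p, w₀ (prj p) / Real.sqrt (LinearMap.det (A (prj p))) ∂ν' = ∫ p in S, w₀ p / Real.sqrt (LinearMap.det (A p)) ∂ν := by
    rw [hν']
    refine setIntegral_congr_fun hS fun p hp => ?_
    simp only [hprjid p hp]
  rw [hmain] at hbd
  exact ⟨hint, hbd⟩

end CubicOffOn

end Summit.QuantumFields.YangMills.Theorems.QuantitativeLaplace

end
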